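import Literature.AlgebraicGeometry.Motives.StandardConjecturesProofs
import Literature.AlgebraicGeometry.Motives.StandardConjecturesKunnethProofs
import Literature.AlgebraicGeometry.Motives.CorrespondencesAlgebraicOperators
import Literature.AlgebraicGeometry.Motives.CorrespondencesTraceFormula
import Literature.AlgebraicGeometry.Motives.CharpolyOfRationalTraces
import HarnessLib

/-!
# Discharged fact: `B(X) ∧ Hdg(X × X) ⇒ D(X)` (hodge.S29)

`Literature.AlgebraicGeometry.Motives.StandardConjectures` records as a named fact (hodge.S29)
`Literature.AlgebraicGeometry.Motives.standardConjectureD_of_standardConjectureB_of_standardConjectureHdg : Prop`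
— for a Weil cohomology theory `W` with the hard Lefschetz property, `X` smooth projective of
dimension `n` with hyperplane class `η`, a hyperplane class `η₂` on `X × X`, Grothendieck's
standard conjecture of Lefschetz type `B(X, η)` (`θ`-form) and the Hodge standard conjecture
`Hdg(X × X, η₂)`, homological and numerical equivalence agree on `X` (`D(X)`)
(S. Kleiman, *Algebraic cycles and the Weil conjectures* (1968), §2 (Cor. 2.5, independence of
`B` from the polarisation) and §3 (Thm. 3.11 and its corollaries); S. Kleiman, *The standard
conjectures* (1994), §§4–5; J. Murre, *Lectures on motives* (2004), §4.2.1.2 Remark 2 (a), (b) and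
§4.2.1.4 (1) "`B(X) + Hdg(X) ⇒ D(X)`"; Y. André, *Une introduction aux motifs* (2004), §5.4).
This file **proves** it (`standardConjectureD_of_standardConjectureB_of_standardConjectureHdg_holds`).

## The argument (formal in the axioms of `WeilCohomology`, given hard Lefschetz)

1. **Products of correspondences** (Kleiman 1968 §1.3; Kahn 2020 §3.5): on `Y = X × Z`, the
   class `p₁₃* u ∪ p₂₄* v ∈ A(Y × Y)_ℚ` induces the external tensor product `A ⊠ B` of the
   operators induced by `u` on `X` and `v` on `Z` (`WeilCohomology.tensorOp`,
   `WeilCohomology.isAlgebraicOperator_tensorOp`). The heart is the separation-of-variables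
   identity `WeilCohomology.trace_pairing_prj` for Kleiman's pairing
   `tr_{Y×Y} ((P₁* ξ ∪ w) ∪ P₂* ζ)`, proved by Künneth induction and an eight-fold reshuffle in
   the graded-commutative algebra `H•(Y × Y)` (`WeilCohomology.cup_pairing_prj_ext`).
2. **`B(X, η) ⇒ B(X × X, η₂)` for every hyperplane class `η₂`** (Kleiman 1968 §2, Cor. 2.5 with
   the independence of the polarisation; Kleiman 1994 Thm 4-1; Murre 2004 §4.2.1.2 Remark 2 (a);
   `WeilCohomology.standardConjectureB_tensor_self`): the operators
   `ιₐ : Hᵃ(X) ⥲ H²ⁿ⁻ᵃ(X)` (`Lⁿ⁻ᵃ` for `a ≤ n`, `θ` for `a > n`) are algebraic and bijective, so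
   `Φ = ⊕ ιₐ ⊠ ι_b : H⁴ⁿ⁻ⁱ(X × X) → Hⁱ(X × X)` is an algebraic isomorphism (`phiOp`; injective
   by the explicit inverse `psiOp`), `g = Φ ∘ L₂ʳ` is an algebraic automorphism of `Hⁱ(X × X)`
   (`L₂` the Lefschetz operator of `η₂`, hard Lefschetz for `η₂`), its powers are algebraic with
   rational traces (Lefschetz trace formula, `exists_rat_trace_of_isAlgebraicOperator` of
   `CorrespondencesTraceFormula`), hence `g⁻¹ = ∑ qₘ gᵐ` with `qₘ ∈ ℚ` (Cayley–Hamilton,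
   `LinearMap.exists_inverse_eq_sum_ratCast_smul_pow` of `CharpolyOfRationalTraces`) and
   `θ₂ = ∑ qₘ (gᵐ ∘ Φ)` is an algebraic inverse of `L₂ʳ`. No Künneth projector of `X × X` is used;
   those of `X` come from `B(X) ⇒ C(X)` (`standardConjectureC_of_standardConjectureB_holds`).
3. **`B(Y, η₂) ∧ Hdg(Y, η₂) ⇒ D(Y)`** for `Y = X × X`: the theorem
   `standardConjectureD_of_standardConjectureB_of_standardConjectureHdg_self` of
   `StandardConjecturesProofs` (Kleiman 1968 §3; Murre 2004 §4.2.1.4).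
4. **`D(X × Z) ⇒ D(X)`** (`WeilCohomology.standardConjectureD_of_standardConjectureD_tensor`): for
   `x ∈ Aᵖ(X)_ℚ` numerically trivial, `pr₁* x` is numerically trivial by the projection formula
   `tr (pr₁* x ∪ ζ) = tr (x ∪ pr₁₊ ζ)` with `pr₁₊ ζ` algebraic
   (`WeilCohomology.pushforward_mem_ratAlgebraicClasses`: `pr₁₊` is induced by the transpose of the
   graph class, Kleiman 1968 §1.3), hence zero; and `pr₁*` is injective
   (`tr_{X×Z} (pr₁* (x ∪ y) ∪ pr₂* ω) = tr_X (x ∪ y) tr_Z ω`).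

No statement of `StandardConjectures.lean` is restated or modified; no named fact is introduced.
Products of smooth projective varieties are smooth projective by the discharged fact
`IsSmoothProjective.tensor_holds`.

## References

* S. L. Kleiman, *Algebraic cycles and the Weil conjectures*, in: Dix exposés sur la cohomologie
  des schémas, North-Holland (1968), 359–386, §1.3, §2 (Prop. 2.3, Cor. 2.5), §3 (Thm. 3.11).
  [Kleiman1968AlgebraicCycles] (not held; acquisition requested)
* S. L. Kleiman, *The standard conjectures*, in: Motives (Seattle 1991), Proc. Sympos. Pure Math.
  55, Part 1 (1994), 3–20, Thm 4-1, §5. [Kleiman1994]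
* J. P. Murre, *Lectures on motives*, in: Transcendental Aspects of Algebraic Cycles (Grenoble
  2001), LMS Lecture Note Ser. 313 (2004), §4.2.1.2 Remark 2, §4.2.1.4 (held:
  book:muller-stach2004-…, PDF pp. 135–136). [Murre2004LecturesMotives]
* B. Kahn, *Zeta and L-functions of varieties and motives*, LMS Lecture Note Ser. 462 (2020),
  §3.5.1–3.5.4 (direct image, correspondences, transposition, trace formula; held, PDF pp. 51–53).
  [Kahn2020]
* Y. André, *Une introduction aux motifs*, Panoramas et Synthèses 17 (2004), §5.4. [Andre2004]
-/

universe u v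

open CategoryTheory AlgebraicGeometry MonoidalCategory CartesianMonoidalCategory Opposite
open scoped TensorProduct DirectSum

noncomputable section

namespace Literature.AlgebraicGeometry.Motives

/-! ## Products of correspondences: the projections `p₁₃`, `p₂₄` of `(X × Z) × (X × Z)` -/

section ProjectionsXZ

variable {k : Type u} [Field k] (X Z : SchemeOver k)

/-- The projection `p₁₃ : (X × Z) × (X × Z) → X × X`. [folklore] -/
def prj₁₃ : (X ⊗ Z) ⊗ (X ⊗ Z) ⟶ X ⊗ X := lift (fst _ _ ≫ fst X Z) (snd _ _ ≫ fst X Z)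

/-- The projection `p₂₄ : (X × Z) × (X × Z) → Z × Z`. [folklore] -/
def prj₂₄ : (X ⊗ Z) ⊗ (X ⊗ Z) ⟶ Z ⊗ Z := lift (fst _ _ ≫ snd X Z) (snd _ _ ≫ snd X Z)

/-- `p₁₃ ≫ pr₁ = P₁ ≫ pr₁` (the projection `π₁`). [folklore] -/
@[simp, reassoc]
lemma prj₁₃_fst : prj₁₃ X Z ≫ fst X X = fst _ _ ≫ fst X Z := lift_fst _ _

/-- `p₁₃ ≫ pr₂ = P₂ ≫ pr₁` (the projection `π₃`). [folklore] -/
@[simp, reassoc]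
lemma prj₁₃_snd : prj₁₃ X Z ≫ snd X X = snd _ _ ≫ fst X Z := lift_snd _ _

/-- `p₂₄ ≫ pr₁ = P₁ ≫ pr₂` (the projection `π₂`). [folklore] -/
@[simp, reassoc]
lemma prj₂₄_fst : prj₂₄ X Z ≫ fst Z Z = fst _ _ ≫ snd X Z := lift_fst _ _

/-- `p₂₄ ≫ pr₂ = P₂ ≫ pr₂` (the projection `π₄`). [folklore] -/
@[simp, reassoc]
lemma prj₂₄_snd : prj₂₄ X Z ≫ snd Z Z = snd _ _ ≫ snd X Z := lift_snd _ _

end ProjectionsXZ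

namespace WeilCohomology

variable {k : Type u} [Field k] {K : Type v} [Field K] [CharZero K] (W : WeilCohomology k K)

section PullbacksXZ

variable {X Z : SchemeOver k}

/-- `p₁₃* pr₁* = P₁* pr₁*` (both are `π₁*`). [folklore] -/
lemma pullback_prj₁₃_fst (i : ℕ) (a : W.obj X i) :
    W.pullback (prj₁₃ X Z) i (W.pullback (fst X X) i a) =
      W.pullback (fst (X ⊗ Z) (X ⊗ Z)) i (W.pullback (fst X Z) i a) := by
  rw [← LinearMap.comp_apply, ← W.pullback_comp, prj₁₃_fst, W.pullback_comp, LinearMap.comp_apply]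

/-- `p₁₃* pr₂* = P₂* pr₁*` (both are `π₃*`). [folklore] -/
lemma pullback_prj₁₃_snd (i : ℕ) (a : W.obj X i) :
    W.pullback (prj₁₃ X Z) i (W.pullback (snd X X) i a) =
      W.pullback (snd (X ⊗ Z) (X ⊗ Z)) i (W.pullback (fst X Z) i a) := by
  rw [← LinearMap.comp_apply, ← W.pullback_comp, prj₁₃_snd, W.pullback_comp, LinearMap.comp_apply]

/-- `p₂₄* pr₁* = P₁* pr₂*` (both are `π₂*`). [folklore] -/
lemma pullback_prj₂₄_fst (i : ℕ) (b : W.obj Z i) :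
    W.pullback (prj₂₄ X Z) i (W.pullback (fst Z Z) i b) =
      W.pullback (fst (X ⊗ Z) (X ⊗ Z)) i (W.pullback (snd X Z) i b) := by
  rw [← LinearMap.comp_apply, ← W.pullback_comp, prj₂₄_fst, W.pullback_comp, LinearMap.comp_apply]

/-- `p₂₄* pr₂* = P₂* pr₂*` (both are `π₄*`). [folklore] -/
lemma pullback_prj₂₄_snd (i : ℕ) (b : W.obj Z i) :
    W.pullback (prj₂₄ X Z) i (W.pullback (snd Z Z) i b) =
      W.pullback (snd (X ⊗ Z) (X ⊗ Z)) i (W.pullback (snd X Z) i b) := by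
  rw [← LinearMap.comp_apply, ← W.pullback_comp, prj₂₄_snd, W.pullback_comp, LinearMap.comp_apply]

end PullbacksXZ

section MiddleFour

variable {nV : ℕ} {V : SchemeOver k}

/-- **Middle-four interchange** in the graded-commutative algebra `H•(V)`:
`(A ∪ B) ∪ (C ∪ D) = (-1)^{|B||C|} (A ∪ C) ∪ (B ∪ D)` (`cup_assoc`, `cup_comm`). [folklore] -/
theorem cup_cup_cup_cup_swap (hV : IsSmoothProjective nV V) {a b c d e₁ e₂ f₁ f₂ N' : ℕ}
    (hab : a + b = e₁) (hcd : c + d = e₂) (h : e₁ + e₂ = N') (hac : a + c = f₁) (hbd : b + d = f₂)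
    (h' : f₁ + f₂ = N') (A : W.obj V a) (B : W.obj V b) (C : W.obj V c) (D : W.obj V d) :
    W.cup h (W.cup hab A B) (W.cup hcd C D) =
      (((b * c : ℕ) : ℤ).negOnePow : ℤ) • W.cup h' (W.cup hac A C) (W.cup hbd B D) := by
  have hbe : b + e₂ = b + e₂ := rfl
  have h₂ : a + (b + e₂) = N' := by omega
  have hbc : b + c = b + c := rfl
  have hcb : c + b = b + c := by omega
  have h₁' : b + c + d = b + e₂ := by omega
  have hcf : c + f₂ = b + e₂ := by omega
  rw [W.cup_assoc hV hab hbe h h₂, ← W.cup_assoc hV hbc hcd h₁' hbe, W.cup_comm hV hbc hcb B C,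
    ← Int.cast_smul_eq_zsmul K, LinearMap.map_smul₂, LinearMap.map_smul,
    W.cup_assoc hV hcb hbd h₁' hcf, ← W.cup_assoc hV hac hcf h' h₂, Int.cast_smul_eq_zsmul]
  push_cast
  rfl

end MiddleFour

section EightFold

variable {n m : ℕ} {X Z : SchemeOver k}

/-- **The eight-fold reshuffle on `(X × Z) × (X × Z)`.** For external products
`u = pr₁* a ∪ pr₂* a'` on `X × X` and `v = pr₁* b ∪ pr₂* b'` on `Z × Z`, and
`ξ = pr₁* x ∪ pr₂* z`, `ζ = pr₁* x' ∪ pr₂* z'` on `Y = X × Z`, Kleiman's pairing integrand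
`(P₁* ξ ∪ (p₁₃* u ∪ p₂₄* v)) ∪ P₂* ζ` on `Y × Y` equals
`(-1)^{|a'||b| + |z||a| + |x'||b'|} · P₁* ((x ∪ a) ⊠ (z ∪ b)) ⊠ P₂* ((a' ∪ x') ⊠ (b' ∪ z'))`
(`map_cup`, `pullback_comp`, `cup_assoc`, `cup_comm`). [folklore] -/
theorem cup_pairing_prj_ext (hX : IsSmoothProjective n X) (hZ : IsSmoothProjective m Z)
    {i l s s' t t' i' l' cu cv cw d₁ e NN f₁ g₁ f₂ g₂ F₁ F₂ : ℕ}
    (hss' : s + s' = cu) (htt' : t + t' = cv) (hil : i + l = d₁) (hil' : i' + l' = e)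
    (hw : cu + cv = cw) (hm : d₁ + cw + e = NN) (hf₁ : i + s = f₁) (hg₁ : l + t = g₁)
    (hf₂ : s' + i' = f₂) (hg₂ : t' + l' = g₂) (hF₁ : f₁ + g₁ = F₁) (hF₂ : f₂ + g₂ = F₂)
    (hΩ : F₁ + F₂ = NN) (x : W.obj X i) (z : W.obj Z l) (a : W.obj X s) (a' : W.obj X s')
    (b : W.obj Z t) (b' : W.obj Z t') (x' : W.obj X i') (z' : W.obj Z l') :
    W.cup hm (W.cup rfl (W.pullback (fst (X ⊗ Z) (X ⊗ Z)) d₁ (W.externalCup X Z hil x z))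
        (W.cup hw (W.pullback (prj₁₃ X Z) cu (W.externalCup X X hss' a a'))
          (W.pullback (prj₂₄ X Z) cv (W.externalCup Z Z htt' b b'))))
      (W.pullback (snd (X ⊗ Z) (X ⊗ Z)) e (W.externalCup X Z hil' x' z')) =
    (((s' * t + l * s + i' * t' : ℕ) : ℤ).negOnePow : ℤ) •
      W.externalCup (X ⊗ Z) (X ⊗ Z) hΩ
        (W.externalCup X Z hF₁ (W.cup hf₁ x a) (W.cup hg₁ z b))
        (W.externalCup X Z hF₂ (W.cup hf₂ a' x') (W.cup hg₂ b' z')) := by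
  have hY := IsSmoothProjective.tensor_holds hX hZ
  have hXX := IsSmoothProjective.tensor_holds hX hX
  have hZZ := IsSmoothProjective.tensor_holds hZ hZ
  have hYY := IsSmoothProjective.tensor_holds hY hY
  -- names for the eight pulled-back classes
  set X₁ := W.pullback (fst (X ⊗ Z) (X ⊗ Z)) i (W.pullback (fst X Z) i x) with hX₁
  set Z₂ := W.pullback (fst (X ⊗ Z) (X ⊗ Z)) l (W.pullback (snd X Z) l z) with hZ₂
  set A₁ := W.pullback (fst (X ⊗ Z) (X ⊗ Z)) s (W.pullback (fst X Z) s a) with hA₁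
  set A₃ := W.pullback (snd (X ⊗ Z) (X ⊗ Z)) s' (W.pullback (fst X Z) s' a') with hA₃
  set B₂ := W.pullback (fst (X ⊗ Z) (X ⊗ Z)) t (W.pullback (snd X Z) t b) with hB₂
  set B₄ := W.pullback (snd (X ⊗ Z) (X ⊗ Z)) t' (W.pullback (snd X Z) t' b') with hB₄
  set X₃ := W.pullback (snd (X ⊗ Z) (X ⊗ Z)) i' (W.pullback (fst X Z) i' x') with hX₃
  set Z₄ := W.pullback (snd (X ⊗ Z) (X ⊗ Z)) l' (W.pullback (snd X Z) l' z') with hZ₄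
  -- expand the four pulled-back external products
  have e₁ : W.pullback (fst (X ⊗ Z) (X ⊗ Z)) d₁ (W.externalCup X Z hil x z) = W.cup hil X₁ Z₂ := by
    rw [W.externalCup_apply, W.map_cup hYY hY (fst _ _) hil]
  have e₂ : W.pullback (prj₁₃ X Z) cu (W.externalCup X X hss' a a') = W.cup hss' A₁ A₃ := by
    rw [W.externalCup_apply, W.map_cup hYY hXX (prj₁₃ X Z) hss', pullback_prj₁₃_fst,
      pullback_prj₁₃_snd]
  have e₃ : W.pullback (prj₂₄ X Z) cv (W.externalCup Z Z htt' b b') = W.cup htt' B₂ B₄ := by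
    rw [W.externalCup_apply, W.map_cup hYY hZZ (prj₂₄ X Z) htt', pullback_prj₂₄_fst,
      pullback_prj₂₄_snd]
  have e₄ : W.pullback (snd (X ⊗ Z) (X ⊗ Z)) e (W.externalCup X Z hil' x' z') = W.cup hil' X₃ Z₄ := by
    rw [W.externalCup_apply, W.map_cup hYY hY (snd _ _) hil']
  rw [e₁, e₂, e₃, e₄]
  -- step (i): `(A₁ ∪ A₃) ∪ (B₂ ∪ B₄) = ± (A₁ ∪ B₂) ∪ (A₃ ∪ B₄)`
  have hst : s + t = s + t := rfl
  have hs't' : s' + t' = s' + t' := rfl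
  have hw' : s + t + (s' + t') = cw := by omega
  rw [W.cup_cup_cup_cup_swap hYY hss' htt' hw hst hs't' hw' A₁ A₃ B₂ B₄,
    ← Int.cast_smul_eq_zsmul K, LinearMap.map_smul, LinearMap.map_smul₂]
  -- step (ii): reassociate `(P ∪ (M₁ ∪ M₂)) ∪ Q = (P ∪ M₁) ∪ (M₂ ∪ Q)`
  have hPM : d₁ + (s + t) = F₁ := by omega
  have hPMM : F₁ + (s' + t') = d₁ + cw := by omega
  have hMQ : s' + t' + e = F₂ := by omega
  rw [← W.cup_assoc hYY hPM hw' hPMM rfl, W.cup_assoc hYY hPMM hMQ hm hΩ]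
  -- step (iii): the two middle-four interchanges
  rw [W.cup_cup_cup_cup_swap hYY hil hst hPM hf₁ hg₁ hF₁ X₁ Z₂ A₁ B₂,
    W.cup_cup_cup_cup_swap hYY hs't' hil' hMQ hf₂ hg₂ hF₂ A₃ B₄ X₃ Z₄,
    ← Int.cast_smul_eq_zsmul K, ← Int.cast_smul_eq_zsmul K, LinearMap.map_smul,
    LinearMap.map_smul₂, smul_smul, smul_smul, cast_negOnePow_mul, cast_negOnePow_mul]
  -- step (iv): fold back into external products
  rw [hX₁, hA₁, ← W.map_cup hYY hY (fst _ _) hf₁, ← W.map_cup hY hX (fst X Z) hf₁,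
    hZ₂, hB₂, ← W.map_cup hYY hY (fst _ _) hg₁, ← W.map_cup hY hZ (snd X Z) hg₁,
    hA₃, hX₃, ← W.map_cup hYY hY (snd _ _) hf₂, ← W.map_cup hY hX (fst X Z) hf₂,
    hB₄, hZ₄, ← W.map_cup hYY hY (snd _ _) hg₂, ← W.map_cup hY hZ (snd X Z) hg₂,
    ← W.map_cup hYY hY (fst _ _) hF₁, ← W.map_cup hYY hY (snd _ _) hF₂,
    ← W.externalCup_apply, ← W.externalCup_apply, ← W.externalCup_apply, Int.cast_smul_eq_zsmul]
  congr 2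
  push_cast
  ring_nf

/-- Parity bookkeeping: if `p + q` is even then `p` and `q` have the same parity. [folklore] -/
lemma even_iff_even_of_add_eq_two_mul {p q r : ℕ} (h : p + q = 2 * r) : (Even p ↔ Even q) :=
  ⟨fun ⟨w, hw⟩ ↦ ⟨r - w, by omega⟩, fun ⟨w, hw⟩ ↦ ⟨r - w, by omega⟩⟩

/-- Parity bookkeeping: if `p + 2r = q + 2s` then `p` and `q` have the same parity. [folklore] -/
lemma even_iff_even_of_add_eq_add {p q r s : ℕ} (h : p + 2 * r = q + 2 * s) : (Even p ↔ Even q) :=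
  ⟨fun ⟨w, hw⟩ ↦ ⟨w + r - s, by omega⟩, fun ⟨w, hw⟩ ↦ ⟨w + s - r, by omega⟩⟩

/-- The eight-fold reshuffle under the trace, in the top multidegree: Kleiman's pairing of
`p₁₃* (a ⊠ a') ∪ p₂₄* (b ⊠ b')` against `x ⊠ z` and `x' ⊠ z'` is
`± tr_X (x ∪ a) tr_Z (z ∪ b) tr_X (a' ∪ x') tr_Z (b' ∪ z')` (`trace_externalCup` twice). [folklore] -/
theorem trace_pairing_prj_ext_of_eq (hX : IsSmoothProjective n X) (hZ : IsSmoothProjective m Z)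
    {i l s s' t t' i' l' cu cv cw d₁ e : ℕ}
    (hss' : s + s' = cu) (htt' : t + t' = cv) (hil : i + l = d₁) (hil' : i' + l' = e)
    (hw : cu + cv = cw) (hm : d₁ + cw + e = 2 * (n + m + (n + m))) (hA : i + s = 2 * n)
    (hB : l + t = 2 * m) (hA' : s' + i' = 2 * n) (hB' : t' + l' = 2 * m) (x : W.obj X i)
    (z : W.obj Z l) (a : W.obj X s) (a' : W.obj X s') (b : W.obj Z t) (b' : W.obj Z t')
    (x' : W.obj X i') (z' : W.obj Z l') :
    W.trace ((X ⊗ Z) ⊗ (X ⊗ Z)) (n + m + (n + m)) (W.cup hm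
      (W.cup rfl (W.pullback (fst (X ⊗ Z) (X ⊗ Z)) d₁ (W.externalCup X Z hil x z))
        (W.cup hw (W.pullback (prj₁₃ X Z) cu (W.externalCup X X hss' a a'))
          (W.pullback (prj₂₄ X Z) cv (W.externalCup Z Z htt' b b'))))
      (W.pullback (snd (X ⊗ Z) (X ⊗ Z)) e (W.externalCup X Z hil' x' z'))) =
    (((s' * t + l * s + i' * t' : ℕ) : ℤ).negOnePow : ℤ) •
      (W.trace X n (W.cup hA x a) * W.trace Z m (W.cup hB z b) *
        (W.trace X n (W.cup hA' a' x') * W.trace Z m (W.cup hB' b' z'))) := by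
  have hY := IsSmoothProjective.tensor_holds hX hZ
  have h1 : 2 * n + 2 * m = 2 * (n + m) := by omega
  have h2 : 2 * (n + m) + 2 * (n + m) = 2 * (n + m + (n + m)) := by omega
  rw [W.cup_pairing_prj_ext hX hZ hss' htt' hil hil' hw hm hA hB hA' hB' h1 h1 h2, map_zsmul,
    W.trace_externalCup hY hY, W.trace_externalCup hX hZ, W.trace_externalCup hX hZ]

/-- The eight-fold reshuffle under the trace vanishes off the top multidegree. [folklore] -/
theorem trace_pairing_prj_ext_eq_zero (hX : IsSmoothProjective n X) (hZ : IsSmoothProjective m Z)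
    {i l s s' t t' i' l' cu cv cw d₁ e : ℕ}
    (hss' : s + s' = cu) (htt' : t + t' = cv) (hil : i + l = d₁) (hil' : i' + l' = e)
    (hw : cu + cv = cw) (hm : d₁ + cw + e = 2 * (n + m + (n + m)))
    (H : ¬ (i + s = 2 * n ∧ l + t = 2 * m ∧ s' + i' = 2 * n ∧ t' + l' = 2 * m)) (x : W.obj X i)
    (z : W.obj Z l) (a : W.obj X s) (a' : W.obj X s') (b : W.obj Z t) (b' : W.obj Z t')
    (x' : W.obj X i') (z' : W.obj Z l') :
    W.trace ((X ⊗ Z) ⊗ (X ⊗ Z)) (n + m + (n + m)) (W.cup hm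
      (W.cup rfl (W.pullback (fst (X ⊗ Z) (X ⊗ Z)) d₁ (W.externalCup X Z hil x z))
        (W.cup hw (W.pullback (prj₁₃ X Z) cu (W.externalCup X X hss' a a'))
          (W.pullback (prj₂₄ X Z) cv (W.externalCup Z Z htt' b b'))))
      (W.pullback (snd (X ⊗ Z) (X ⊗ Z)) e (W.externalCup X Z hil' x' z'))) = 0 := by
  have hY := IsSmoothProjective.tensor_holds hX hZ
  by_cases h₁ : i + s + (l + t) = 2 * (n + m)
  · by_cases hA : i + s = 2 * n
    · have hB : l + t = 2 * m := by omega
      have hA' : ¬ s' + i' = 2 * n := fun hA' ↦ H ⟨hA, hB, hA', by omega⟩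
      have hF₂ : s' + i' + (t' + l') = 2 * (n + m) := by omega
      rw [W.cup_pairing_prj_ext hX hZ hss' htt' hil hil' hw hm rfl rfl rfl rfl h₁ hF₂ (by omega),
        W.externalCup_eq_zero_of_ne hX hZ hF₂ hA' (W.cup rfl a' x'), map_zero, smul_zero, map_zero]
    · rw [W.cup_pairing_prj_ext hX hZ hss' htt' hil hil' hw hm rfl rfl rfl rfl h₁ rfl (by omega),
        W.externalCup_eq_zero_of_ne hX hZ h₁ hA (W.cup rfl x a), LinearMap.map_zero₂, smul_zero,
        map_zero]
  · rw [W.cup_pairing_prj_ext hX hZ hss' htt' hil hil' hw hm rfl rfl rfl rfl rfl rfl (by omega),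
      W.externalCup_eq_zero_of_ne hY hY _ h₁, smul_zero, map_zero]

/-- **Separation of variables for Kleiman's pairing on a product.** For even-degree classes
`u ∈ H(X × X)`, `v ∈ H(Z × Z)` and external products `ξ = x ⊠ z`, `ζ = x' ⊠ z'` on `Y = X × Z`
in complementary multidegrees, the pairing `tr_{Y×Y} ((P₁* ξ ∪ (p₁₃* u ∪ p₂₄* v)) ∪ P₂* ζ)`
is `(-1)^{|x||z|}` times the product of the pairings `tr_{X×X} ((pr₁* x ∪ u) ∪ pr₂* x')` and
`tr_{Z×Z} ((pr₁* z ∪ v) ∪ pr₂* z')` (Kleiman 1968 §1.3: products of correspondences act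
factorwise modulo Künneth; Kahn 2020 §3.5.2). [cite: Kleiman1968AlgebraicCycles, §1.3] -/
theorem trace_pairing_prj (hX : IsSmoothProjective n X) (hZ : IsSmoothProjective m Z)
    {cA cB i l i' l' d₁ e : ℕ} (u : W.obj (X ⊗ X) (2 * cA)) (v : W.obj (Z ⊗ Z) (2 * cB))
    (hil : i + l = d₁) (hil' : i' + l' = e) (hw : 2 * cA + 2 * cB = 2 * (cA + cB))
    (hmX : i + 2 * cA + i' = 2 * (n + n)) (hmZ : l + 2 * cB + l' = 2 * (m + m))
    (hm : d₁ + 2 * (cA + cB) + e = 2 * (n + m + (n + m))) (x : W.obj X i) (z : W.obj Z l)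
    (x' : W.obj X i') (z' : W.obj Z l') :
    W.trace ((X ⊗ Z) ⊗ (X ⊗ Z)) (n + m + (n + m)) (W.cup hm
      (W.cup rfl (W.pullback (fst (X ⊗ Z) (X ⊗ Z)) d₁ (W.externalCup X Z hil x z))
        (W.cup hw (W.pullback (prj₁₃ X Z) (2 * cA) u) (W.pullback (prj₂₄ X Z) (2 * cB) v)))
      (W.pullback (snd (X ⊗ Z) (X ⊗ Z)) e (W.externalCup X Z hil' x' z'))) =
    (((i * l : ℕ) : ℤ).negOnePow : ℤ) •
      (W.trace (X ⊗ X) (n + n)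
          (W.cup hmX (W.cup rfl (W.pullback (fst X X) i x) u) (W.pullback (snd X X) i' x')) *
        W.trace (Z ⊗ Z) (m + m)
          (W.cup hmZ (W.cup rfl (W.pullback (fst Z Z) l z) v) (W.pullback (snd Z Z) l' z'))) := by
  induction u using W.kunneth_induction hX hX with
  | zero => simp
  | add w w' hw₁ hw₂ =>
    simp only [map_add, LinearMap.add_apply] at hw₁ hw₂ ⊢
    rw [hw₁, hw₂, ← smul_add, ← add_mul]
  | ext s s' hss' a a' =>
    induction v using W.kunneth_induction hZ hZ with
    | zero => simp
    | add w w' hw₁ hw₂ =>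
      simp only [map_add, LinearMap.add_apply] at hw₁ hw₂ ⊢
      rw [hw₁, hw₂, ← smul_add, ← mul_add]
    | ext t t' htt' b b' =>
      by_cases H : i + s = 2 * n ∧ l + t = 2 * m ∧ s' + i' = 2 * n ∧ t' + l' = 2 * m
      · obtain ⟨hA, hB, hA', hB'⟩ := H
        rw [W.trace_pairing_prj_ext_of_eq hX hZ hss' htt' hil hil' hw hm hA hB hA' hB',
          W.trace_cup_cup_externalCup_of_eq hX hX hss' hmX hA hA',
          W.trace_cup_cup_externalCup_of_eq hZ hZ htt' hmZ hB hB']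
        have hsign : ((s' * t + l * s + i' * t' : ℕ) : ℤ).negOnePow = ((i * l : ℕ) : ℤ).negOnePow := by
          have p₁ := even_iff_even_of_add_eq_two_mul hA
          have p₂ := even_iff_even_of_add_eq_two_mul hss'
          have p₃ := even_iff_even_of_add_eq_two_mul hA'
          have q₁ := even_iff_even_of_add_eq_two_mul hB
          have q₂ := even_iff_even_of_add_eq_two_mul htt'
          have q₃ := even_iff_even_of_add_eq_two_mul hB'
          rw [Int.negOnePow_eq_iff, Int.even_sub]
          simp only [Nat.cast_add, Nat.cast_mul, Int.even_add, Int.even_mul, Int.even_coe_nat]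
          tauto
        rw [hsign, mul_mul_mul_comm]
      · rw [W.trace_pairing_prj_ext_eq_zero hX hZ hss' htt' hil hil' hw hm H]
        by_cases hA : i + s = 2 * n
        · have hB : ¬ l + t = 2 * m := fun hB ↦ H ⟨hA, hB, by omega, by omega⟩
          rw [W.trace_cup_cup_externalCup_of_ne hZ hZ htt' hmZ hB, mul_zero, smul_zero]
        · rw [W.trace_cup_cup_externalCup_of_ne hX hX hss' hmX hA, zero_mul, smul_zero]

/-- Companion of `trace_pairing_prj` in the degenerate range: if the `X`-degrees are not
complementary (`|x| + |u| + |x'| ≠ 4 dim X`) the pairing vanishes. [folklore] -/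
theorem trace_pairing_prj_eq_zero (hX : IsSmoothProjective n X) (hZ : IsSmoothProjective m Z)
    {cA cB i l i' l' d₁ e : ℕ} (u : W.obj (X ⊗ X) (2 * cA)) (v : W.obj (Z ⊗ Z) (2 * cB))
    (hil : i + l = d₁) (hil' : i' + l' = e) (hw : 2 * cA + 2 * cB = 2 * (cA + cB))
    (hmX : i + 2 * cA + i' ≠ 2 * (n + n))
    (hm : d₁ + 2 * (cA + cB) + e = 2 * (n + m + (n + m))) (x : W.obj X i) (z : W.obj Z l)
    (x' : W.obj X i') (z' : W.obj Z l') :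
    W.trace ((X ⊗ Z) ⊗ (X ⊗ Z)) (n + m + (n + m)) (W.cup hm
      (W.cup rfl (W.pullback (fst (X ⊗ Z) (X ⊗ Z)) d₁ (W.externalCup X Z hil x z))
        (W.cup hw (W.pullback (prj₁₃ X Z) (2 * cA) u) (W.pullback (prj₂₄ X Z) (2 * cB) v)))
      (W.pullback (snd (X ⊗ Z) (X ⊗ Z)) e (W.externalCup X Z hil' x' z'))) = 0 := by
  induction u using W.kunneth_induction hX hX with
  | zero => simp
  | add w w' hw₁ hw₂ =>
    simp only [map_add, LinearMap.add_apply] at hw₁ hw₂ ⊢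
    rw [hw₁, hw₂, add_zero]
  | ext s s' hss' a a' =>
    induction v using W.kunneth_induction hZ hZ with
    | zero => simp
    | add w w' hw₁ hw₂ =>
      simp only [map_add, LinearMap.add_apply] at hw₁ hw₂ ⊢
      rw [hw₁, hw₂, add_zero]
    | ext t t' htt' b b' =>
      exact W.trace_pairing_prj_ext_eq_zero hX hZ hss' htt' hil hil' hw hm
        (fun H ↦ hmX (by omega)) x z a a' b b' x' z'

end EightFold

/-! ## External tensor products of operators on `H•(X × Z)` -/

section TensorOp

variable {n m : ℕ} {X Z : SchemeOver k}

/-- The index of the Künneth summand `Hⁱ(X) ⊗ Hˡ(Z)` of `Hᵈ(X × Z)`, `i + l = d`. Private copy of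
`WeilCohomology.kIdx` (`AbelianVarietyHopf`), kept local so as not to import that module. [folklore] -/
private abbrev kIdx₂ {i l d : ℕ} (h : i + l = d) : ↥(Finset.antidiagonal d) :=
  ⟨(i, l), Finset.mem_antidiagonal.mpr h⟩

/-- The Künneth isomorphism `⨁_{i+l=d} Hⁱ(X) ⊗ Hˡ(Z) ≃ Hᵈ(X × Z)` (axiom (B),
`bijective_kunnethMap`; Kleiman 1968 §1.2 (B)). Private copy of `WeilCohomology.kunnethEquiv`
(`AbelianVarietyHopf`), kept local so as not to import that module. [cite: Kleiman1968AlgebraicCycles, §1.2 (B)] -/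
private def kunnethEquiv₂ (hX : IsSmoothProjective n X) (hZ : IsSmoothProjective m Z) (d : ℕ) :
    (⨁ ij : ↥(Finset.antidiagonal d), W.obj X ij.1.1 ⊗[K] W.obj Z ij.1.2) ≃ₗ[K] W.obj (X ⊗ Z) d :=
  LinearEquiv.ofBijective (W.kunnethMap X Z d) (W.bijective_kunnethMap hX hZ d)

/-- The inverse Künneth isomorphism on an external product `x ⊠ z` is the elementary tensor
`x ⊗ z` placed in bidegree `(|x|, |z|)`. [folklore] -/
lemma kunnethEquiv_symm_externalCup (hX : IsSmoothProjective n X) (hZ : IsSmoothProjective m Z)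
    {i l d : ℕ} (h : i + l = d) (x : W.obj X i) (z : W.obj Z l) :
    (W.kunnethEquiv₂ hX hZ d).symm (W.externalCup X Z h x z) =
      DirectSum.lof K _ (fun ij : ↥(Finset.antidiagonal d) ↦ W.obj X ij.1.1 ⊗[K] W.obj Z ij.1.2)
        (kIdx₂ h) (x ⊗ₜ z) := by
  rw [LinearEquiv.symm_apply_eq]
  change _ = W.kunnethMap X Z d _
  rw [DirectSum.lof_eq_of, W.kunnethMap_of_tmul]

/-- The **external tensor product** `A ⊠ B` of operators `A : Hᵃ(X) → Hᵃ²(X)` and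
`B : Hᵇ(Z) → Hᵇ²(Z)`, as an operator `Hᵈ(X × Z) → Hᵈ²(X × Z)` (`a + b = d`, `a₂ + b₂ = d₂`):
through the Künneth isomorphism it is `A ⊗ B` on the summand `Hᵃ(X) ⊗ Hᵇ(Z)` and zero on the
other summands (Kleiman 1968 §1.3, the correspondence `u ⊗ v` on a product). [cite: Kleiman1968AlgebraicCycles, §1.3] -/
def tensorOp (hX : IsSmoothProjective n X) (hZ : IsSmoothProjective m Z) {a b d a₂ b₂ d₂ : ℕ}
    (hab : a + b = d) (hab₂ : a₂ + b₂ = d₂) (A : W.obj X a →ₗ[K] W.obj X a₂)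
    (B : W.obj Z b →ₗ[K] W.obj Z b₂) : W.obj (X ⊗ Z) d →ₗ[K] W.obj (X ⊗ Z) d₂ :=
  W.kunnethMap X Z d₂ ∘ₗ
    DirectSum.lof K _ (fun ij : ↥(Finset.antidiagonal d₂) ↦ W.obj X ij.1.1 ⊗[K] W.obj Z ij.1.2)
      (kIdx₂ hab₂) ∘ₗ
    TensorProduct.map A B ∘ₗ
    DirectSum.component K _ (fun ij : ↥(Finset.antidiagonal d) ↦ W.obj X ij.1.1 ⊗[K] W.obj Z ij.1.2)
      (kIdx₂ hab) ∘ₗ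
    (W.kunnethEquiv₂ hX hZ d).symm.toLinearMap

/-- `(A ⊠ B) (x ⊠ z) = A x ⊠ B z` on the summand `Hᵃ(X) ⊗ Hᵇ(Z)`. [folklore] -/
theorem tensorOp_externalCup_same (hX : IsSmoothProjective n X) (hZ : IsSmoothProjective m Z)
    {a b d a₂ b₂ d₂ : ℕ} (hab : a + b = d) (hab₂ : a₂ + b₂ = d₂) (A : W.obj X a →ₗ[K] W.obj X a₂)
    (B : W.obj Z b →ₗ[K] W.obj Z b₂) (hab' : a + b = d) (x : W.obj X a) (z : W.obj Z b) :
    W.tensorOp hX hZ hab hab₂ A B (W.externalCup X Z hab' x z) = W.externalCup X Z hab₂ (A x) (B z) := by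
  change W.tensorOp hX hZ hab hab₂ A B (W.externalCup X Z hab x z) = _
  simp only [tensorOp, LinearMap.coe_comp, LinearEquiv.coe_coe, Function.comp_apply]
  rw [W.kunnethEquiv_symm_externalCup hX hZ hab, DirectSum.component.lof_self, TensorProduct.map_tmul,
    DirectSum.lof_eq_of, W.kunnethMap_of_tmul]

/-- `(A ⊠ B) (x ⊠ z) = 0` on the other Künneth summands `(|x|, |z|) ≠ (a, b)`. [folklore] -/
theorem tensorOp_externalCup_of_ne (hX : IsSmoothProjective n X) (hZ : IsSmoothProjective m Z)
    {a b d a₂ b₂ d₂ : ℕ} (hab : a + b = d) (hab₂ : a₂ + b₂ = d₂) (A : W.obj X a →ₗ[K] W.obj X a₂)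
    (B : W.obj Z b →ₗ[K] W.obj Z b₂) {i l : ℕ} (hil : i + l = d) (hne : ¬ (i = a ∧ l = b))
    (x : W.obj X i) (z : W.obj Z l) :
    W.tensorOp hX hZ hab hab₂ A B (W.externalCup X Z hil x z) = 0 := by
  simp only [tensorOp, LinearMap.coe_comp, LinearEquiv.coe_coe, Function.comp_apply]
  rw [W.kunnethEquiv_symm_externalCup hX hZ hil, DirectSum.component.of, dif_neg, map_zero,
    map_zero, map_zero]
  intro h
  apply hne
  have h' := congrArg (fun p : ↥(Finset.antidiagonal d) ↦ p.1) h
  simp only [Prod.mk.injEq] at h'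
  exact h'

/-- Kleiman's pairing of a class inducing a single-component operator `A : Hᵃ(X) → Hᵃ²(X)`,
evaluated in the source degree `a`: `tr_{X×X} ((pr₁* x ∪ u) ∪ pr₂* x') = tr_X (A x ∪ x')`. [folklore] -/
theorem trace_pairing_of_induces_single_same {a a₂ cA : ℕ}
    {A : W.obj X a →ₗ[K] W.obj X a₂} {u : W.obj (X ⊗ X) (2 * cA)}
    (hu : ∀ (i j i' : ℕ) (hj : j + i' = 2 * n) (hm : i + 2 * cA + i' = 2 * (n + n)),
      2 * cA + i = j + 2 * n →
        W.IsInducedBy n n u (PreWeilCohomology.GradedOp.ofLinearMap A i j) hj hm)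
    {i' : ℕ} (hmX : a + 2 * cA + i' = 2 * (n + n)) (hj : a₂ + i' = 2 * n) (x : W.obj X a)
    (x' : W.obj X i') :
    W.trace (X ⊗ X) (n + n)
        (W.cup hmX (W.cup rfl (W.pullback (fst X X) a x) u) (W.pullback (snd X X) i' x')) =
      W.trace X n (W.cup hj (A x) x') := by
  have h := hu a a₂ i' hj hmX (by omega)
  rw [PreWeilCohomology.GradedOp.ofLinearMap_apply_same] at h
  exact (h x x').symm

/-- Kleiman's pairing of a class inducing a single-component operator `A : Hᵃ(X) → Hᵃ²(X)`
(and zero in the other degrees) vanishes in source degrees `i ≠ a`. [folklore] -/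
theorem trace_pairing_of_induces_single_ne (hX : IsSmoothProjective n X) {a a₂ cA : ℕ}
    {A : W.obj X a →ₗ[K] W.obj X a₂} {u : W.obj (X ⊗ X) (2 * cA)}
    (hu : ∀ (i j i' : ℕ) (hj : j + i' = 2 * n) (hm : i + 2 * cA + i' = 2 * (n + n)),
      2 * cA + i = j + 2 * n →
        W.IsInducedBy n n u (PreWeilCohomology.GradedOp.ofLinearMap A i j) hj hm)
    {i i' : ℕ} (hmX : i + 2 * cA + i' = 2 * (n + n)) (hi : i ≠ a) (x : W.obj X i)
    (x' : W.obj X i') :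
    W.trace (X ⊗ X) (n + n)
        (W.cup hmX (W.cup rfl (W.pullback (fst X X) i x) u) (W.pullback (snd X X) i' x')) = 0 := by
  by_cases hi' : i' ≤ 2 * n
  · have h := hu i (2 * n - i') i' (by omega) hmX (by omega)
    rw [PreWeilCohomology.GradedOp.ofLinearMap_apply_of_ne _ (fun h ↦ hi h.1.symm)] at h
    rw [← h x x', LinearMap.zero_apply, LinearMap.map_zero₂, map_zero]
  · haveI := W.subsingleton_obj hX (i := i') (by omega)
    rw [Subsingleton.elim x' 0, map_zero, map_zero, map_zero]

/-- From `IsAlgebraicOperator`: the class in the relevant codimension induces the single-component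
operator, in the form consumed by `trace_pairing_of_induces_single_same/ne`. [folklore] -/
theorem induces_single_of_isAlgebraicOperator {a a₂ cA : ℕ} {A : W.obj X a →ₗ[K] W.obj X a₂}
    {u : ∀ c : ℕ, ↥(W.ratAlgebraicClasses (X ⊗ X) c)}
    (hu : ∀ (i j c j' : ℕ) (hj : j + j' = 2 * n) (hm : i + 2 * c + j' = 2 * (n + n)),
      2 * c + i = j + 2 * n →
        W.IsInducedBy n n (u c : W.obj (X ⊗ X) (2 * c)) (PreWeilCohomology.GradedOp.ofLinearMap A i j)
          hj hm) :
    ∀ (i j i' : ℕ) (hj : j + i' = 2 * n) (hm : i + 2 * cA + i' = 2 * (n + n)),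
      2 * cA + i = j + 2 * n →
        W.IsInducedBy n n (u cA : W.obj (X ⊗ X) (2 * cA)) (PreWeilCohomology.GradedOp.ofLinearMap A i j)
          hj hm :=
  fun i j i' hj hm hc ↦ hu i j cA i' hj hm hc

/-- **External tensor products of algebraic operators are algebraic** (Kleiman 1968 §1.3: for
algebraic correspondences `u` on `X` and `v` on `Z`, `u ⊗ v = p₁₃* u · p₂₄* v` is an algebraic
correspondence on `X × Z` inducing the tensor product of the operators; Kahn 2020 §3.5). If
`A : Hᵃ(X) → Hᵃ²(X)` and `B : Hᵇ(Z) → Hᵇ²(Z)` are induced by algebraic correspondences with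
`ℚ`-coefficients (as single-component operators), so is `A ⊠ B : Hᵃ⁺ᵇ(X × Z) → Hᵃ²⁺ᵇ²(X × Z)`.

Depends only on: `IsSmoothProjective.tensor_holds`, `pullback_ratAlgebraicClasses_le`,
`cup_mem_ratAlgebraicClasses`, `bijective_kunnethMap` (Künneth induction and the definition of
`A ⊠ B`), `trace_externalCup`, `subsingleton_obj`, `cup_assoc`, `cup_comm`, `map_cup`,
`pullback_comp` (`trace_pairing_prj`). [cite: Kleiman1968AlgebraicCycles, §1.3] -/
theorem isAlgebraicOperator_tensorOp (hX : IsSmoothProjective n X) (hZ : IsSmoothProjective m Z)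
    {a b d a₂ b₂ d₂ : ℕ} (hab : a + b = d) (hab₂ : a₂ + b₂ = d₂) {A : W.obj X a →ₗ[K] W.obj X a₂}
    {B : W.obj Z b →ₗ[K] W.obj Z b₂} (hA : W.IsAlgebraicOperator n n A)
    (hB : W.IsAlgebraicOperator m m B) :
    W.IsAlgebraicOperator (n + m) (n + m) (W.tensorOp hX hZ hab hab₂ A B) := by
  classical
  have hY := IsSmoothProjective.tensor_holds hX hZ
  have hXX := IsSmoothProjective.tensor_holds hX hX
  have hZZ := IsSmoothProjective.tensor_holds hZ hZ
  have hYY := IsSmoothProjective.tensor_holds hY hY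
  obtain ⟨uf, huf, huf0⟩ := hA
  obtain ⟨vf, hvf, hvf0⟩ := hB
  -- degenerate case: no codimension for `A` or for `B`, then the operator vanishes
  by_cases hdeg : (∃ cA, 2 * cA + a = a₂ + 2 * n) ∧ (∃ cB, 2 * cB + b = b₂ + 2 * m)
  swap
  · have h0 : W.tensorOp hX hZ hab hab₂ A B = 0 := by
      rcases not_and_or.mp hdeg with h | h
      · have hA0 : A = 0 := by
          have := huf0 a a₂ h
          rwa [PreWeilCohomology.GradedOp.ofLinearMap_apply_same] at this
        simp [tensorOp, hA0, TensorProduct.map_zero_left]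
      · have hB0 : B = 0 := by
          have := hvf0 b b₂ h
          rwa [PreWeilCohomology.GradedOp.ofLinearMap_apply_same] at this
        simp [tensorOp, hB0, TensorProduct.map_zero_right]
    rw [h0]
    exact W.isAlgebraicOperator_zero
  obtain ⟨⟨cA, hcA⟩, ⟨cB, hcB⟩⟩ := hdeg
  have hu := W.induces_single_of_isAlgebraicOperator (cA := cA) huf
  have hv := W.induces_single_of_isAlgebraicOperator (cA := cB) hvf
  set u : W.obj (X ⊗ X) (2 * cA) := (uf cA : W.obj (X ⊗ X) (2 * cA)) with hu_def
  set v : W.obj (Z ⊗ Z) (2 * cB) := (vf cB : W.obj (Z ⊗ Z) (2 * cB)) with hv_def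
  have hw : 2 * cA + 2 * cB = 2 * (cA + cB) := by omega
  have hwmem : W.cup hw (W.pullback (prj₁₃ X Z) (2 * cA) u) (W.pullback (prj₂₄ X Z) (2 * cB) v) ∈
      W.ratAlgebraicClasses ((X ⊗ Z) ⊗ (X ⊗ Z)) (cA + cB) :=
    W.cup_mem_ratAlgebraicClasses hYY rfl _ _
      (W.pullback_ratAlgebraicClasses_le hYY hXX (prj₁₃ X Z) cA ⟨u, (uf cA).2, rfl⟩)
      (W.pullback_ratAlgebraicClasses_le hYY hZZ (prj₂₄ X Z) cB ⟨v, (vf cB).2, rfl⟩)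
  let wSub : ↥(W.ratAlgebraicClasses ((X ⊗ Z) ⊗ (X ⊗ Z)) (cA + cB)) := ⟨_, hwmem⟩
  set T := W.tensorOp hX hZ hab hab₂ A B with hT_def
  -- the value of the components of `ofLinearMap T` on external products
  have hTval : ∀ (d₁ d₂' i l : ℕ) (hil : i + l = d₁) (x : W.obj X i) (z : W.obj Z l),
      ¬ (d₁ = d ∧ d₂' = d₂ ∧ i = a ∧ l = b) →
        PreWeilCohomology.GradedOp.ofLinearMap T d₁ d₂' (W.externalCup X Z hil x z) = 0 := by
    intro d₁ d₂' i l hil x z hne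
    by_cases hdd : d = d₁ ∧ d₂ = d₂'
    · obtain ⟨rfl, rfl⟩ := hdd
      rw [PreWeilCohomology.GradedOp.ofLinearMap_apply_same]
      exact W.tensorOp_externalCup_of_ne hX hZ hab hab₂ A B hil (fun h ↦ hne ⟨rfl, rfl, h⟩) x z
    · rw [PreWeilCohomology.GradedOp.ofLinearMap_apply_of_ne _ hdd, LinearMap.zero_apply]
  refine ⟨fun c ↦ if hc : cA + cB = c then hc ▸ wSub else 0, fun d₁ d₂' c e hj hm hc' ↦ ?_,
    fun d₁ d₂' hne ↦ ?_⟩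
  · by_cases hcc : cA + cB = c
    · subst hcc
      simp only [dite_true]
      intro ξ ζ
      change W.trace (X ⊗ Z) (n + m)
          (W.cup hj (PreWeilCohomology.GradedOp.ofLinearMap T d₁ d₂' ξ) ζ) =
        W.trace ((X ⊗ Z) ⊗ (X ⊗ Z)) (n + m + (n + m)) (W.cup hm
          (W.cup rfl (W.pullback (fst (X ⊗ Z) (X ⊗ Z)) d₁ ξ)
            (W.cup hw (W.pullback (prj₁₃ X Z) (2 * cA) u) (W.pullback (prj₂₄ X Z) (2 * cB) v)))
          (W.pullback (snd (X ⊗ Z) (X ⊗ Z)) e ζ))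
      induction ξ using W.kunneth_induction hX hZ with
      | zero => simp
      | add w w' hw₁ hw₂ =>
        simp only [map_add, LinearMap.add_apply] at hw₁ hw₂ ⊢
        rw [hw₁, hw₂]
      | ext i l hil x z =>
        induction ζ using W.kunneth_induction hX hZ with
        | zero => simp
        | add w w' hw₁ hw₂ =>
          simp only [map_add] at hw₁ hw₂ ⊢
          rw [hw₁, hw₂]
        | ext i' l' hil' x' z' =>
          by_cases hmX : i + 2 * cA + i' = 2 * (n + n)
          · have hmZ : l + 2 * cB + l' = 2 * (m + m) := by omega
            rw [W.trace_pairing_prj hX hZ u v hil hil' hw hmX hmZ hm]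
            by_cases hia : i = a ∧ l = b
            · obtain ⟨rfl, rfl⟩ := hia
              obtain rfl : d = d₁ := by omega
              obtain rfl : d₂ = d₂' := by omega
              have hjX : a₂ + i' = 2 * n := by omega
              have hjZ : b₂ + l' = 2 * m := by omega
              rw [PreWeilCohomology.GradedOp.ofLinearMap_apply_same, hT_def,
                W.tensorOp_externalCup_same hX hZ hab hab₂ A B hil,
                W.cup_externalCup_externalCup hX hZ hab₂ hil' hj hjX hjZ (by omega),
                ← Int.cast_smul_eq_zsmul K, map_smul, W.trace_externalCup hX hZ,
                W.trace_pairing_of_induces_single_same hu hmX hjX,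
                W.trace_pairing_of_induces_single_same hv hmZ hjZ, Int.cast_smul_eq_zsmul]
              have hsign : ((b₂ : ℤ) * i').negOnePow = ((i * l : ℕ) : ℤ).negOnePow := by
                have p₁ : Even l ↔ Even b₂ := even_iff_even_of_add_eq_add (r := cB) (s := m) (by omega)
                have p₂ : Even i ↔ Even a₂ := even_iff_even_of_add_eq_add (r := cA) (s := n) (by omega)
                have p₃ := even_iff_even_of_add_eq_two_mul hjX
                rw [Int.negOnePow_eq_iff, Int.even_sub]
                simp only [Nat.cast_mul, Int.even_mul, Int.even_coe_nat]
                tauto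
              rw [hsign]
            · rw [hTval d₁ d₂' i l hil x z (fun h ↦ hia ⟨h.2.2.1, h.2.2.2⟩), LinearMap.map_zero₂,
                map_zero]
              rcases not_and_or.mp hia with hi | hl
              · rw [W.trace_pairing_of_induces_single_ne hX hu hmX hi, zero_mul, smul_zero]
              · rw [W.trace_pairing_of_induces_single_ne hZ hv hmZ hl, mul_zero, smul_zero]
          · rw [W.trace_pairing_prj_eq_zero hX hZ u v hil hil' hw hmX hm]
            by_cases hia : d₁ = d ∧ d₂' = d₂ ∧ i = a ∧ l = b
            · obtain ⟨rfl, rfl, rfl, rfl⟩ := hia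
              rw [PreWeilCohomology.GradedOp.ofLinearMap_apply_same, hT_def,
                W.tensorOp_externalCup_same hX hZ hab hab₂ A B hil,
                W.cup_externalCup_externalCup hX hZ hab₂ hil' hj rfl rfl (by omega),
                W.externalCup_eq_zero_of_ne hX hZ _ (by omega : a₂ + i' ≠ 2 * n), smul_zero,
                map_zero]
            · rw [hTval d₁ d₂' i l hil x z hia, LinearMap.map_zero₂, map_zero]
    · dsimp only
      rw [dif_neg hcc]
      have hne : ¬ (d = d₁ ∧ d₂ = d₂') := fun h ↦ hcc (by omega)
      rw [PreWeilCohomology.GradedOp.ofLinearMap_apply_of_ne _ hne]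
      simpa using W.isInducedBy_zero
  · exact PreWeilCohomology.GradedOp.ofLinearMap_apply_of_ne _ fun h ↦ hne ⟨cA + cB, by omega⟩

end TensorOp

/-! ## Push-forward preserves algebraic classes; `D(X × Z) ⇒ D(X)` -/

section Pushforward

variable {N M : ℕ} {V U : SchemeOver k}

/-- **Push-forward preserves rational algebraic classes**: for `f : V → U` between smooth
projective varieties, the Poincaré-duality adjoint `f₊` of `f*` (`pushforward`) maps
`Aᵃ(V)_ℚ` into `Aᵇ(U)_ℚ` (`a + M = b + N`): `f*` is induced by the rational algebraic class of
the transposed graph (`exists_isInducedBy_pullback`), hence `f₊` by its transpose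
(`isInducedBy_transposeClass_of_adjoint`), and algebraic correspondences preserve rational
algebraic classes (`map_ratAlgebraicClasses_of_isInducedBy`) (Kleiman 1968 §1.3; Kahn 2020
§3.5.1). [cite: Kleiman1968AlgebraicCycles, §1.3] -/
theorem pushforward_mem_ratAlgebraicClasses (hV : IsSmoothProjective N V)
    (hU : IsSmoothProjective M U) (f : V ⟶ U) {a b d' : ℕ} (he : 2 * a + d' = 2 * N)
    (hd : 2 * b + d' = 2 * M) {α : W.obj V (2 * a)} (hα : α ∈ W.ratAlgebraicClasses V a) :
    W.pushforward (N := N) hU f he hd α ∈ W.ratAlgebraicClasses U b := by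
  have hUV := IsSmoothProjective.tensor_holds hU hV
  have hVU := IsSmoothProjective.tensor_holds hV hU
  obtain ⟨γ, hγ, hγi⟩ := W.exists_isInducedBy_pullback hV hU f
  have hind : W.IsInducedBy N M (W.transposeClass γ) (W.pushforward (N := N) hU f he hd) hd
      (show 2 * a + 2 * M + d' = 2 * (N + M) by omega) := by
    refine W.isInducedBy_transposeClass_of_adjoint hU hV (hγi d' (2 * a) (by omega))
      (by omega : d' + 2 * b = 2 * M) ?_ hd _
    intro β μ
    change W.trace _ _ (W.cup _ (W.pullback f d' β) μ) =
      W.trace _ _ (W.cup _ β (W.pushforward hU f he hd μ))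
    rw [W.cup_comm_of_even hV _ he (Or.inr ⟨a, two_mul a⟩),
      W.cup_comm_of_even hU _ hd (Or.inr ⟨b, two_mul b⟩), W.trace_cup_pushforward]
  exact W.map_ratAlgebraicClasses_of_isInducedBy hV hU (W.transposeClass γ) _ hd _
    (W.pullback_ratAlgebraicClasses_le hVU hUV (β_ _ _).hom M ⟨γ, hγ, rfl⟩) hind _ hα

end Pushforward

section DProduct

variable {n m : ℕ} {X Z : SchemeOver k}

/-- **`D(X × Z) ⇒ D(X)`** (Kleiman 1968 §3; the standard reduction): if homological and
numerical equivalence agree on `X × Z` (`X`, `Z` smooth projective), they agree on `X`. For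
`x ∈ Aᵖ(X)_ℚ` numerically trivial, `pr₁* x` is numerically trivial on `X × Z` by the projection
formula `tr (pr₁* x ∪ ζ) = tr (x ∪ pr₁₊ ζ)` and the algebraicity of `pr₁₊ ζ`
(`pushforward_mem_ratAlgebraicClasses`), hence `pr₁* x = 0`; and `pr₁*` is injective:
`tr_{X×Z} (pr₁* (x ∪ y) ∪ pr₂* ω) = tr_X (x ∪ y) · tr_Z ω` (`trace_externalCup`) with
`tr_X (x ∪ y) ≠ 0` for a suitable `y` (Poincaré duality) and `tr_Z ω = 1`.
[cite: Kleiman1968AlgebraicCycles, §3] -/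
theorem standardConjectureD_of_standardConjectureD_tensor (hX : IsSmoothProjective n X)
    (hZ : IsSmoothProjective m Z) (hD : W.StandardConjectureD (n + m) (X ⊗ Z)) :
    W.StandardConjectureD n X := by
  have hXZ := IsSmoothProjective.tensor_holds hX hZ
  intro p q hpq x hx hperp
  have h2 : 2 * p + 2 * q = 2 * n := by omega
  -- `pr₁* x` is numerically trivial on `X × Z`, hence zero
  have hξ : W.pullback (fst X Z) (2 * p) x ∈ W.ratAlgebraicClasses (X ⊗ Z) p :=
    W.pullback_ratAlgebraicClasses_le hXZ hX (fst X Z) p ⟨x, hx, rfl⟩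
  have hξ0 : W.pullback (fst X Z) (2 * p) x = 0 := by
    refine hD p (q + m) (by omega) _ hξ fun ζ hζ ↦ ?_
    have he : 2 * (q + m) + 2 * p = 2 * (n + m) := by omega
    rw [cupPairing_apply, W.cup_comm_of_even hXZ _ he (Or.inl ⟨p, two_mul p⟩),
      ← W.trace_cup_pushforward (N := n + m) hX (fst X Z) he (show 2 * q + 2 * p = 2 * n by omega),
      W.cup_comm_of_even hX _ h2 (Or.inr ⟨p, two_mul p⟩)]
    exact hperp _ (W.pushforward_mem_ratAlgebraicClasses hXZ hX (fst X Z) he _ hζ)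
  -- `pr₁*` is injective
  by_contra hx0
  haveI := W.isPerfPair_cupPairing hX (2 * p) (2 * q) h2
  have hne : W.cupPairing X n (2 * p) (2 * q) h2 x ≠ 0 := fun h ↦
    hx0 ((LinearMap.IsPerfPair.bijective_left (W.cupPairing X n (2 * p) (2 * q) h2)).1
      (by rw [h, map_zero]))
  obtain ⟨y, hy⟩ : ∃ y, W.cupPairing X n (2 * p) (2 * q) h2 x y ≠ 0 := by
    by_contra! h
    exact hne (LinearMap.ext h)
  obtain ⟨ω, hω⟩ := (W.bijective_trace hZ).2 1
  have key := W.trace_externalCup hX hZ (W.cup h2 x y) ω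
  rw [W.externalCup_apply, W.map_cup hXZ hX (fst X Z) h2, hξ0, LinearMap.map_zero₂,
    LinearMap.map_zero₂, map_zero, hω, mul_one] at key
  exact hy (by rw [cupPairing_apply, ← key])

end DProduct

/-! ## From `B(X, η)` to `B(X × X, η₂)` for every hyperplane class `η₂` -/

section BProduct

variable {n : ℕ} {X : SchemeOver k} {η : W.obj X 2}

/-- Under `B(X, η)` (`θ`-form), the **algebraic isomorphisms `ιₐ : Hᵃ(X) ⥲ H²ⁿ⁻ᵃ(X)`**: the
hard-Lefschetz map `Lⁿ⁻ᵃ` for `a ≤ n` and the operator `θ` of `B(X, η)` (inverse of `Lᵃ⁻ⁿ`) for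
`a > n` (Kleiman 1968 §2). [cite: Kleiman1968AlgebraicCycles, §2] -/
def iotaOp (hB : W.StandardConjectureB n X η) {a a' : ℕ} (h : a + a' = 2 * n) :
    W.obj X a →ₗ[K] W.obj X a' :=
  if ha : a ≤ n then W.lefschetzPow X η (n - a) a a' (by omega)
  else (hB a' (a - n) a (by omega) (by omega)).choose

/-- The operators `ιₐ` are bijective (hard Lefschetz, contained in the `θ`-form of `B(X, η)`). [folklore] -/
theorem iotaOp_bijective (hB : W.StandardConjectureB n X η) {a a' : ℕ} (h : a + a' = 2 * n) :
    Function.Bijective (W.iotaOp hB h) := by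
  unfold iotaOp
  split_ifs with ha
  · exact hB.bijective_lefschetzPow (by omega) _
  · obtain ⟨-, h₁, h₂⟩ := (hB a' (a - n) a (by omega) (by omega)).choose_spec.1
    set θ := (hB a' (a - n) a (by omega) (by omega)).choose
    refine ⟨fun x y hxy ↦ ?_, fun y ↦ ⟨W.lefschetzPow X η (a - n) a' a (by omega) y, ?_⟩⟩
    · have := congrArg (W.lefschetzPow X η (a - n) a' a (by omega)) hxy
      rwa [← LinearMap.comp_apply, ← LinearMap.comp_apply, h₂, LinearMap.id_apply,
        LinearMap.id_apply] at this
    · rw [← LinearMap.comp_apply, h₁, LinearMap.id_apply]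

/-- The operators `ιₐ` are algebraic single-component operators: for `a ≤ n`,
`Lⁿ⁻ᵃ|_{Hᵃ} = π²ⁿ⁻ᵃ ∘ Lⁿ⁻ᵃ` with the Künneth projector `π²ⁿ⁻ᵃ` algebraic by `B(X) ⇒ C(X)`
(`standardConjectureC_of_standardConjectureB_holds`) and `IsAlgebraicOperator.comp_lefschetzPow`;
for `a > n` by `B(X, η)` itself (Kleiman 1968 §2, Prop. 2.3; Kleiman 1994 Thm 4-1). [cite: Kleiman1968AlgebraicCycles, §2 Prop. 2.3] -/
theorem isAlgebraicOperator_iotaOp (hX : IsSmoothProjective n X) (hη : W.IsHyperplaneClass X η)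
    (hB : W.StandardConjectureB n X η) {a a' : ℕ} (h : a + a' = 2 * n) :
    W.IsAlgebraicOperator n n (W.iotaOp hB h) := by
  unfold iotaOp
  split_ifs with ha
  · have hC := WeilCohomology.standardConjectureC_iff.mp
      (standardConjectureC_of_standardConjectureB_holds hX hη hB) a'
    have := hC.comp_lefschetzPow hX hX hη (a := a) (r := n - a) (by omega : a + 2 * (n - a) = a')
    rwa [LinearMap.id_comp] at this
  · exact (hB a' (a - n) a (by omega) (by omega)).choose_spec.2

/-- `ιₐ` as a linear equivalence. [folklore] -/
def iotaEquiv (hB : W.StandardConjectureB n X η) {a a' : ℕ} (h : a + a' = 2 * n) :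
    W.obj X a ≃ₗ[K] W.obj X a' :=
  LinearEquiv.ofBijective (W.iotaOp hB h) (W.iotaOp_bijective hB h)

/-- **The algebraic isomorphism `Φ : Hʲ(X × X) → Hⁱ(X × X)`**, `i + j = 4n`: on the Künneth summand
`Hᵃ(X) ⊗ Hᵇ(X)` (`a + b = j`, `a, b ≤ 2n`) it is `ιₐ ⊠ ι_b` into `H²ⁿ⁻ᵃ(X) ⊗ H²ⁿ⁻ᵇ(X)`
(Kleiman 1968 §2, proof that `B(X) ⇒ B(X × X)`: the operators of `X × X` are tensor products of
those of `X`). [cite: Kleiman1968AlgebraicCycles, §2] -/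
def phiOp (hX : IsSmoothProjective n X) (hB : W.StandardConjectureB n X η) {i j : ℕ}
    (hij : i + j = 2 * (n + n)) : W.obj (X ⊗ X) j →ₗ[K] W.obj (X ⊗ X) i :=
  ∑ p ∈ (Finset.antidiagonal j).attach,
    if hp : p.1.1 ≤ 2 * n ∧ p.1.2 ≤ 2 * n then
      W.tensorOp hX hX (Finset.mem_antidiagonal.mp p.2)
        (show (2 * n - p.1.1) + (2 * n - p.1.2) = i by
          have := Finset.mem_antidiagonal.mp p.2; omega)
        (W.iotaOp hB (show p.1.1 + (2 * n - p.1.1) = 2 * n by omega))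
        (W.iotaOp hB (show p.1.2 + (2 * n - p.1.2) = 2 * n by omega))
    else 0

/-- The (not necessarily algebraic) inverse `Ψ : Hⁱ(X × X) → Hʲ(X × X)` of `Φ`: `ιₐ⁻¹ ⊠ ι_b⁻¹` on
the summand `H²ⁿ⁻ᵃ(X) ⊗ H²ⁿ⁻ᵇ(X)`. [folklore] -/
def psiOp (hX : IsSmoothProjective n X) (hB : W.StandardConjectureB n X η) {i j : ℕ}
    (hij : i + j = 2 * (n + n)) : W.obj (X ⊗ X) i →ₗ[K] W.obj (X ⊗ X) j :=
  ∑ p ∈ (Finset.antidiagonal j).attach,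
    if hp : p.1.1 ≤ 2 * n ∧ p.1.2 ≤ 2 * n then
      W.tensorOp hX hX
        (show (2 * n - p.1.1) + (2 * n - p.1.2) = i by
          have := Finset.mem_antidiagonal.mp p.2; omega)
        (Finset.mem_antidiagonal.mp p.2)
        (W.iotaEquiv hB (show p.1.1 + (2 * n - p.1.1) = 2 * n by omega)).symm.toLinearMap
        (W.iotaEquiv hB (show p.1.2 + (2 * n - p.1.2) = 2 * n by omega)).symm.toLinearMap
    else 0

/-- `Φ (x ⊠ z) = ιₐ x ⊠ ι_b z` for `x ∈ Hᵃ(X)`, `z ∈ Hᵇ(X)`, `a, b ≤ 2n`. [folklore] -/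
theorem phiOp_externalCup (hX : IsSmoothProjective n X) (hB : W.StandardConjectureB n X η)
    {i j : ℕ} (hij : i + j = 2 * (n + n)) {a b : ℕ} (hab : a + b = j) (ha : a ≤ 2 * n)
    (hb : b ≤ 2 * n) (h₂ : (2 * n - a) + (2 * n - b) = i) (x : W.obj X a) (z : W.obj X b) :
    W.phiOp hX hB hij (W.externalCup X X hab x z) =
      W.externalCup X X h₂ (W.iotaOp hB (show a + (2 * n - a) = 2 * n by omega) x)
        (W.iotaOp hB (show b + (2 * n - b) = 2 * n by omega) z) := by
  classical
  unfold phiOp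
  rw [LinearMap.sum_apply,
    Finset.sum_eq_single (⟨(a, b), Finset.mem_antidiagonal.mpr hab⟩ : ↥(Finset.antidiagonal j))]
  · dsimp only
    rw [dif_pos ⟨ha, hb⟩, W.tensorOp_externalCup_same hX hX]
  · rintro ⟨⟨a₁, b₁⟩, hp⟩ - hne
    dsimp only
    split_ifs with hgood
    · apply W.tensorOp_externalCup_of_ne
      exact fun h ↦ hne (Subtype.ext (by simp only [Prod.mk.injEq]; exact ⟨h.1.symm, h.2.symm⟩))
    · rfl
  · intro h
    exact absurd (Finset.mem_attach _ _) h

/-- `Ψ (Φ (x ⊠ z)) = x ⊠ z`. [folklore] -/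
theorem psiOp_phiOp_externalCup (hX : IsSmoothProjective n X) (hB : W.StandardConjectureB n X η)
    {i j : ℕ} (hij : i + j = 2 * (n + n)) {a b : ℕ} (hab : a + b = j) (x : W.obj X a)
    (z : W.obj X b) :
    W.psiOp hX hB hij (W.phiOp hX hB hij (W.externalCup X X hab x z)) = W.externalCup X X hab x z := by
  classical
  by_cases hgood : a ≤ 2 * n ∧ b ≤ 2 * n
  · obtain ⟨ha, hb⟩ := hgood
    have h₂ : (2 * n - a) + (2 * n - b) = i := by omega
    rw [W.phiOp_externalCup hX hB hij hab ha hb h₂]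
    unfold psiOp
    rw [LinearMap.sum_apply,
      Finset.sum_eq_single (⟨(a, b), Finset.mem_antidiagonal.mpr hab⟩ : ↥(Finset.antidiagonal j))]
    · dsimp only
      rw [dif_pos ⟨ha, hb⟩, W.tensorOp_externalCup_same hX hX]
      simp only [LinearEquiv.coe_coe]
      have hx : (W.iotaEquiv hB (show a + (2 * n - a) = 2 * n by omega)).symm
          (W.iotaOp hB (show a + (2 * n - a) = 2 * n by omega) x) = x :=
        (W.iotaEquiv hB _).symm_apply_apply x
      have hz : (W.iotaEquiv hB (show b + (2 * n - b) = 2 * n by omega)).symm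
          (W.iotaOp hB (show b + (2 * n - b) = 2 * n by omega) z) = z :=
        (W.iotaEquiv hB _).symm_apply_apply z
      rw [hx, hz]
    · rintro ⟨⟨a₁, b₁⟩, hp⟩ - hne
      have hp' := Finset.mem_antidiagonal.mp hp
      dsimp only
      split_ifs with hgood
      · apply W.tensorOp_externalCup_of_ne
        exact fun h ↦ hne (Subtype.ext (by simp only [Prod.mk.injEq]; omega))
      · rfl
    · intro h
      exact absurd (Finset.mem_attach _ _) h
  · have hX2 := IsSmoothProjective.tensor_holds hX hX
    have h0 : W.externalCup X X hab x z = 0 := by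
      rcases not_and_or.mp hgood with ha | hb
      · haveI := W.subsingleton_obj hX (i := a) (by omega)
        rw [Subsingleton.elim x 0, LinearMap.map_zero₂]
      · haveI := W.subsingleton_obj hX (i := b) (by omega)
        rw [Subsingleton.elim z 0, map_zero]
    rw [h0, map_zero, map_zero]

/-- `Ψ ∘ Φ = id`; in particular `Φ` is injective. [folklore] -/
theorem psiOp_comp_phiOp (hX : IsSmoothProjective n X) (hB : W.StandardConjectureB n X η)
    {i j : ℕ} (hij : i + j = 2 * (n + n)) :
    W.psiOp hX hB hij ∘ₗ W.phiOp hX hB hij = LinearMap.id := by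
  ext w
  rw [LinearMap.comp_apply, LinearMap.id_apply]
  induction w using W.kunneth_induction hX hX with
  | zero => rw [map_zero, map_zero]
  | add w w' hw hw' => rw [map_add, map_add, hw, hw']
  | ext a b hab x z => exact W.psiOp_phiOp_externalCup hX hB hij hab x z

/-- `Φ` is injective. [folklore] -/
theorem phiOp_injective (hX : IsSmoothProjective n X) (hB : W.StandardConjectureB n X η)
    {i j : ℕ} (hij : i + j = 2 * (n + n)) : Function.Injective (W.phiOp hX hB hij) := by
  intro w w' h
  have := LinearMap.congr_fun (W.psiOp_comp_phiOp hX hB hij) w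
  have h' := LinearMap.congr_fun (W.psiOp_comp_phiOp hX hB hij) w'
  simp only [LinearMap.comp_apply, LinearMap.id_apply] at this h'
  rw [← this, ← h', h]

/-- **`Φ` is algebraic** (sum of tensor products of the algebraic operators `ιₐ`, `ι_b`:
`isAlgebraicOperator_tensorOp`, `isAlgebraicOperator_iotaOp`). [cite: Kleiman1968AlgebraicCycles, §2] -/
theorem isAlgebraicOperator_phiOp (hX : IsSmoothProjective n X) (hη : W.IsHyperplaneClass X η)
    (hB : W.StandardConjectureB n X η) {i j : ℕ} (hij : i + j = 2 * (n + n)) :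
    W.IsAlgebraicOperator (n + n) (n + n) (W.phiOp hX hB hij) := by
  unfold phiOp
  refine PreWeilCohomology.IsAlgebraicOperator.sum _ fun p _ ↦ ?_
  split_ifs with hp
  · exact W.isAlgebraicOperator_tensorOp hX hX _ _ (W.isAlgebraicOperator_iotaOp hX hη hB _)
      (W.isAlgebraicOperator_iotaOp hX hη hB _)
  · exact W.isAlgebraicOperator_zero

/-- **`B(X, η) ⇒ B(X × X, η₂)` for every hyperplane class `η₂` on `X × X`** (Kleiman 1968 §2:
Cor. 2.5 `B(X) ∧ B(Y) ⇒ B(X × Y)` together with the independence of `B` from the polarisation;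
Kleiman 1994 Thm 4-1 and Cor. 4-2; Murre 2004 §4.2.1.2 Remark 2 (a)). Under hard Lefschetz, if
`B(X, η)` holds in `θ`-form then so does `B(X × X, η₂)`.

Printed proof (Lieberman's Cayley–Hamilton argument): for `i + r = 2n`, the hard-Lefschetz
isomorphism `ℓ = L₂ʳ : Hⁱ(X × X) → H⁴ⁿ⁻ⁱ(X × X)` of `η₂` and the algebraic isomorphism
`Φ = ⊕ ιₐ ⊠ ι_b : H⁴ⁿ⁻ⁱ(X × X) → Hⁱ(X × X)` (`phiOp`) give an algebraic automorphism `g = Φ ∘ ℓ`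
of `Hⁱ(X × X)`, all of whose powers are algebraic, hence have rational traces (Lefschetz trace
formula, `exists_rat_trace_of_isAlgebraicOperator` of `CorrespondencesTraceFormula`); by
Cayley–Hamilton with rational
coefficients (`LinearMap.exists_inverse_eq_sum_ratCast_smul_pow`) `g⁻¹ = ∑ qₘ gᵐ`, so
`θ = g⁻¹ ∘ Φ = ∑ qₘ (gᵐ ∘ Φ)` is algebraic and inverse to `ℓ`. No Künneth projector of `X × X`
is needed.

Depends only on: the hypothesis `W.HasHardLefschetz` (for `(X × X, η₂)`), `finite_obj`,
`isAlgebraicOperator_tensorOp`, `IsAlgebraicOperator.comp_lefschetzPow`,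
`isAlgebraicGradedOp_comp_holds`, `standardConjectureC_of_standardConjectureB_holds`,
`exists_rat_trace_of_isAlgebraicOperator` and their listed dependencies. [cite: Kleiman1968AlgebraicCycles, §2 Cor. 2.5] [cite: Murre2004LecturesMotives, §4.2.1.2 Remark 2(a)] -/
theorem standardConjectureB_tensor_self (hL : W.HasHardLefschetz) (hX : IsSmoothProjective n X)
    (hη : W.IsHyperplaneClass X η) (hB : W.StandardConjectureB n X η) {η₂ : W.obj (X ⊗ X) 2}
    (hη₂ : W.IsHyperplaneClass (X ⊗ X) η₂) : W.StandardConjectureB (n + n) (X ⊗ X) η₂ := by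
  classical
  intro i r j hir hij
  have hY := IsSmoothProjective.tensor_holds hX hX
  haveI : FiniteDimensional K (W.obj (X ⊗ X) i) := W.finite_obj hY i
  have hij' : i + j = 2 * (n + n) := by omega
  set ℓ := W.lefschetzPow (X ⊗ X) η₂ r i j hij with hℓ_def
  have hℓ : Function.Bijective ℓ := hL hY η₂ hη₂ i r j hir hij
  set Φ := W.phiOp hX hB hij' with hΦ_def
  have hΦalg : W.IsAlgebraicOperator (n + n) (n + n) Φ := W.isAlgebraicOperator_phiOp hX hη hB hij'
  set g : Module.End K (W.obj (X ⊗ X) i) := Φ ∘ₗ ℓ with hg_def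
  -- `g` is algebraic
  have hgalg : W.IsAlgebraicOperator (n + n) (n + n) g := hΦalg.comp_lefschetzPow hY hY hη₂ hij
  -- `g` is invertible
  have hgbij : Function.Bijective g := by
    have hinj : Function.Injective g := (W.phiOp_injective hX hB hij').comp hℓ.1
    exact ⟨hinj, LinearMap.injective_iff_surjective.mp hinj⟩
  have hunit : IsUnit g := (Module.End.isUnit_iff g).mpr hgbij
  -- the powers of `g` are algebraic, hence have rational traces
  have hpow : ∀ m : ℕ, W.IsAlgebraicOperator (n + n) (n + n) (g ^ (m + 1)) := by
    intro m
    induction m with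
    | zero => simpa using hgalg
    | succ m ih =>
      rw [pow_succ, Module.End.mul_eq_comp]
      exact PreWeilCohomology.IsAlgebraicOperator.comp hY hY hY ih hgalg
  have htr : ∀ m : ℕ, ∃ q : ℚ, LinearMap.trace K _ (g ^ (m + 1)) = q :=
    fun m ↦ W.exists_rat_trace_of_isAlgebraicOperator hY (hpow m)
  -- Cayley–Hamilton with rational coefficients
  obtain ⟨q, hq, -⟩ := LinearMap.exists_inverse_eq_sum_ratCast_smul_pow g hunit htr
  set P : Module.End K (W.obj (X ⊗ X) i) :=
    ∑ m ∈ Finset.range (Module.finrank K (W.obj (X ⊗ X) i)), ((q m : ℚ) : K) • g ^ m with hP_def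
  refine ⟨P ∘ₗ Φ, ⟨hir, ?_, ?_⟩, ?_⟩
  · -- `θ ∘ ℓ = id`
    rw [LinearMap.comp_assoc, ← hg_def, ← Module.End.mul_eq_comp, hq, Module.End.one_eq_id]
  · -- `ℓ ∘ θ = id`
    have h₁ : (P ∘ₗ Φ) ∘ₗ ℓ = LinearMap.id := by
      rw [LinearMap.comp_assoc, ← hg_def, ← Module.End.mul_eq_comp, hq, Module.End.one_eq_id]
    refine LinearMap.ext fun y ↦ ?_
    obtain ⟨x, rfl⟩ := hℓ.2 y
    have := LinearMap.congr_fun h₁ x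
    simp only [LinearMap.comp_apply, LinearMap.id_apply] at this ⊢
    rw [this]
  · -- algebraicity of `θ = ∑ qₘ (gᵐ ∘ Φ)`
    have hpow' : ∀ m : ℕ, W.IsAlgebraicOperator (n + n) (n + n) ((g ^ m) ∘ₗ Φ) := by
      intro m
      induction m with
      | zero =>
        rw [pow_zero, Module.End.one_eq_id, LinearMap.id_comp]
        exact hΦalg
      | succ m ih =>
        rw [pow_succ', Module.End.mul_eq_comp, LinearMap.comp_assoc]
        exact PreWeilCohomology.IsAlgebraicOperator.comp hY hY hY hgalg ih
    have hPΦ : P ∘ₗ Φ = ∑ m ∈ Finset.range (Module.finrank K (W.obj (X ⊗ X) i)),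
        ((q m : ℚ) : K) • ((g ^ m) ∘ₗ Φ) := by
      ext x
      simp [hP_def, LinearMap.sum_apply]
    rw [hPΦ]
    refine PreWeilCohomology.IsAlgebraicOperator.sum _ fun m _ ↦ ?_
    exact PreWeilCohomology.IsAlgebraicOperator.ratCast_smul (hpow' m) (q m)

end BProduct

end WeilCohomology

/-! ## The discharge -/

section Discharge

variable {k : Type u} [Field k] {K : Type v} [Field K] [CharZero K]
variable {W : WeilCohomology k K} {n : ℕ} {X : SchemeOver k} {η : W.obj X 2}

/-- **Discharge of hodge.S29, `B(X) ∧ Hdg(X × X) ⇒ D(X)`** (Kleiman 1968 §3, Thm. 3.11 and its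
corollaries; Kleiman 1994 §5; Murre 2004 §4.2.1.2 Remark 2 and §4.2.1.4; André 2004 §5.4).
Under hard Lefschetz, for `X` smooth projective of dimension `n` with hyperplane class `η`, a
hyperplane class `η₂` on `X × X`, `B(X, η)` and `Hdg(X × X, η₂)` imply `D(X)`.

Proof: `B(X, η) ⇒ B(X × X, η₂)` (`WeilCohomology.standardConjectureB_tensor_self`: tensor products
of the algebraic isomorphisms `ιₐ`, Cayley–Hamilton with rational coefficients via the Lefschetz
trace formula); `B(X × X, η₂) ∧ Hdg(X × X, η₂) ⇒ D(X × X)`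
(`WeilCohomology.standardConjectureD_of_standardConjectureB_of_standardConjectureHdg_self` of
`StandardConjecturesProofs`: Lefschetz decomposition inside the algebraic classes and positivity);
`D(X × X) ⇒ D(X)`
(`WeilCohomology.standardConjectureD_of_standardConjectureD_tensor`: projection formula and
injectivity of `pr₁*`). All formal in the axioms of `WeilCohomology` together with the hypothesis
`W.HasHardLefschetz`. [cite: Kleiman1968AlgebraicCycles, §3 Thm. 3.11] [cite: Murre2004LecturesMotives, §4.2.1.4] -/
theorem standardConjectureD_of_standardConjectureB_of_standardConjectureHdg_holds :
    standardConjectureD_of_standardConjectureB_of_standardConjectureHdg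
      (W := W) (n := n) (X := X) (η := η) := by
  intro hL hX hη η₂ hη₂ hB hHdg
  have hY := IsSmoothProjective.tensor_holds hX hX
  exact W.standardConjectureD_of_standardConjectureD_tensor hX hX
    (W.standardConjectureD_of_standardConjectureB_of_standardConjectureHdg_self hY hη₂
      (W.standardConjectureB_tensor_self hL hX hη hB hη₂) hHdg)

end Discharge

end Literature.AlgebraicGeometry.Motives

end
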